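import Literature.NumberTheory.Weil1964.AdelicMetaplecticFinRep
import HarnessLib

/-!
# Continuity of `z ↦ s_∞(z) · s_f(z)` in `Mp_ψ(W_𝔸)ᶜᵒⁿᵗ` for an archimedean and a finite factor

Topic `NumberTheory/Weil1964`; namespace `Literature.NumberTheory.Weil1964`.  KERNEL only: proved lemmas, no definition,
no named fact, no `sorry`.

[Weil1964, Chap. III n° 37–39 pp. 188–190]: the adelic Weil representation is the product `𝐫_𝐀(s) = ⊗_v 𝐫_v(s_v)` of the
local ones on the standard functions `Φ = ⊗ Φ_v`, and `Mp(X)_A` acts continuously on `𝒮(X_A)`.  In the tree's coefficient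
topology of `Mp_ψ(W_𝔸)` (`AdelicMetaplecticGroup` §4: initial topology of the `π`-orbit maps `p ↦ π(p) w` and of the matrix
coefficients `p ↦ (ω_ψ(p)Φ)(x)`) multiplication is NOT known to be jointly continuous; this file proves the case that the
assembly of a global splitting from its archimedean and finite halves needs:

* `continuous_proj_mul_apply` — for ANY two continuous maps `p, q : Z → Mp_ψ(W_𝔸)` the `π`-orbit maps of `z ↦ p(z) q(z)`
  are continuous (`π(p q) w = π(p) (π(q) w)` is bilinear over the topological ring `𝔸_F` in the matrix of `π(p(z))` — read on
  the basis vectors — and the vector `π(q(z)) w`);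
* `continuous_omegaPsi_mul_apply_of_arch_fin` — if moreover `p, q` take values in `Mp_ψ(W_𝔸)ᶜᵒⁿᵗ`, every `ω(p(z)) = A_z ⊗ 1` is
  ARCHIMEDEAN and every `ω(q(z)) = 1 ⊗ B_z` is FINITE, then the matrix coefficients of `z ↦ p(z) q(z)` are continuous: on a
  factorizable `Φ = Φ_∞ ⊗ Φ_f`, `(ω(p(z) q(z))Φ)(x) = (A_z Φ_∞)(x_∞) · (B_z Φ_f)(x_f)`, and each factor is a matrix coefficient of
  `p` (resp. `q`) ALONE at the test vector `Φ_∞ ⊗ 𝟙_{𝒪̂^ι}` (resp. `φ₀ ⊗ Φ_f`, `φ₀(0) = 1`), hence continuous; general `Φ` are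
  finite sums of factorizable ones (`piSchwartzBruhatEquiv`);
* **`continuous_mul_of_arch_fin`** — consequently `z ↦ p(z) q(z)` is continuous into `Mp_ψ(W_𝔸)ᶜᵒⁿᵗ`.

Written as the GENERIC input of stub S1asm-cont (`stub_S1asm_continuous`: continuity of
`assemble = (s_∞ ∘ archPart) · (s_f ∘ finPart)`) of the kernel construction of [GelbartRogawski1991, Prop. 3.1.1] behind
the cited input `hGRU` of the Hodge-CM period-theorem package (stage-1 cell `pub-hodgecm`, seats GR-1 ∕ GR-2; this file:
seat carch-1, 2026-08-21): there `Z = H(𝔸)`, `p = sa ∘ archPart`, `q = sf ∘ finPart`, and the operator hypotheses are the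
fields `IsArchHalf.isArch`, `IsFinHalf.isFinite`.

## References

* A. Weil, *Sur certains groupes d'opérateurs unitaires*, Acta Math. 111 (1964), Chap. III n° 37–39 [Weil1964].
* S. Gelbart, J. Rogawski, Invent. Math. 105 (1991), §3.1 p. 454 [GelbartRogawski1991].
-/

set_option autoImplicit false

noncomputable section

namespace Literature.NumberTheory.Weil1964

open Literature.RepresentationTheory.HeisenbergGroup
open Literature.NumberTheory.Automorphic
open NumberField NumberField.mixedEmbedding IsDedekindDomain
open scoped TensorProduct SchwartzMap Classical

variable {F : Type} [Field F] [NumberField F] {ι : Type} [Fintype ι] [DecidableEq ι]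
  {T : Matrix ι ι (AdeleRing (𝓞 F) F)} {Z : Type*} [TopologicalSpace Z]

/-! ## §1 `π`-orbits of a product -/

/-- A vector of `𝔸^ι × 𝔸^ι` expanded along the standard basis vectors `(e_i, 0)`, `(0, e_i)`. [folklore] -/
private theorem prod_pi_eq_sum_single {R : Type*} [CommSemiring R] (v : (ι → R) × (ι → R)) :
    v = ∑ i, v.1 i • ((Pi.single i 1, 0) : (ι → R) × (ι → R)) + ∑ i, v.2 i • ((0, Pi.single i 1) : (ι → R) × (ι → R)) := by
  ext j
  · simp [Prod.fst_sum, Finset.sum_apply, Pi.single_apply]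
  · simp [Prod.snd_sum, Finset.sum_apply, Pi.single_apply]

/-- A family of linear maps `L z` of `𝔸^ι × 𝔸^ι` with continuous orbit maps `z ↦ L z w`, applied to a continuously varying
vector `v z`, gives a continuous `z ↦ L z (v z)` (bilinearity over the topological ring). [folklore] -/
private theorem continuous_linearMap_apply_of_orbits {R : Type*} [CommRing R] [TopologicalSpace R] [IsTopologicalRing R]
    (L : Z → (((ι → R) × (ι → R)) →ₗ[R] ((ι → R) × (ι → R))))
    (hL : ∀ w, Continuous fun z => L z w) {v : Z → (ι → R) × (ι → R)} (hv : Continuous v) :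
    Continuous fun z => L z (v z) := by
  have hdecomp : (fun z => L z (v z)) = fun z =>
      ∑ i, (v z).1 i • L z (Pi.single i 1, 0) + ∑ i, (v z).2 i • L z (0, Pi.single i 1) := by
    funext z
    conv_lhs => rw [prod_pi_eq_sum_single (v z)]
    simp only [map_add, map_sum, map_smul]
  rw [hdecomp]
  refine (continuous_finsetSum _ fun i _ => ?_).add (continuous_finsetSum _ fun i _ => ?_)
  · exact (((continuous_apply i).comp (continuous_fst.comp hv)).smul (hL _))
  · exact (((continuous_apply i).comp (continuous_snd.comp hv)).smul (hL _))

/-- **`π`-orbits of a product**: for continuous `p, q : Z → Mp_ψ(W_𝔸)`, the orbit maps `z ↦ π(p(z) q(z)) w` are continuous.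
[cite: Weil1964, Chap. III n° 39 p. 189] -/
theorem continuous_proj_mul_apply {p q : Z → adelicMp F ι T} (hp : Continuous p) (hq : Continuous q)
    (w : (ι → AdeleRing (𝓞 F) F) × (ι → AdeleRing (𝓞 F) F)) :
    Continuous fun z =>
      ((MpPsi.proj (adelicSchrodinger F ι T) (p z * q z) : symplecticGroup (polar (adelicForm F ι T))) :
        ((ι → AdeleRing (𝓞 F) F) × (ι → AdeleRing (𝓞 F) F)) ≃ₗ[AdeleRing (𝓞 F) F]
          ((ι → AdeleRing (𝓞 F) F) × (ι → AdeleRing (𝓞 F) F))) w := by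
  have hmul : ∀ z, ((MpPsi.proj (adelicSchrodinger F ι T) (p z * q z) : symplecticGroup (polar (adelicForm F ι T))) :
        ((ι → AdeleRing (𝓞 F) F) × (ι → AdeleRing (𝓞 F) F)) ≃ₗ[AdeleRing (𝓞 F) F]
          ((ι → AdeleRing (𝓞 F) F) × (ι → AdeleRing (𝓞 F) F))) w =
      (((MpPsi.proj (adelicSchrodinger F ι T) (p z) : symplecticGroup (polar (adelicForm F ι T))) :
        ((ι → AdeleRing (𝓞 F) F) × (ι → AdeleRing (𝓞 F) F)) ≃ₗ[AdeleRing (𝓞 F) F]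
          ((ι → AdeleRing (𝓞 F) F) × (ι → AdeleRing (𝓞 F) F))) : _ →ₗ[AdeleRing (𝓞 F) F] _)
      (((MpPsi.proj (adelicSchrodinger F ι T) (q z) : symplecticGroup (polar (adelicForm F ι T))) :
        ((ι → AdeleRing (𝓞 F) F) × (ι → AdeleRing (𝓞 F) F)) ≃ₗ[AdeleRing (𝓞 F) F]
          ((ι → AdeleRing (𝓞 F) F) × (ι → AdeleRing (𝓞 F) F))) w) := by
    intro z
    rw [map_mul]
    rfl
  simp only [hmul]
  exact continuous_linearMap_apply_of_orbits (fun z => ((MpPsi.proj (adelicSchrodinger F ι T) (p z) :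
      symplecticGroup (polar (adelicForm F ι T))) : ((ι → AdeleRing (𝓞 F) F) × (ι → AdeleRing (𝓞 F) F)) ≃ₗ[AdeleRing (𝓞 F) F]
        ((ι → AdeleRing (𝓞 F) F) × (ι → AdeleRing (𝓞 F) F))).toLinearMap)
    (fun w' => (continuous_proj_apply w').comp hp) ((continuous_proj_apply w).comp hq)

/-! ## §2 Matrix coefficients of an (archimedean) · (finite) product -/

section Coefficients

variable {p q : Z → adelicMpCont F ι T}

/-- the archimedean factor read as a coefficient of `p` alone: `(A_z Φ_∞)(u) = (ω(p z)(Φ_∞ ⊗ 𝟙_{𝒪̂^ι}))(u, 0)`, so it is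
continuous in `z`. [cite: Weil1964, Chap. III n° 38 p. 189] -/
private theorem continuous_archCoeff (hp : Continuous p)
    (A : Z → (𝓢((ι → mixedSpace F), ℂ) →ₗ[ℂ] 𝓢((ι → mixedSpace F), ℂ)))
    (hA : ∀ z, (adelicMpCont.omega F ι T (p z) : ↥(piSchwartzBruhat F ι) →ₗ[ℂ] ↥(piSchwartzBruhat F ι)) =
      adelicTensorEnd (A z) LinearMap.id)
    (Φinf : 𝓢((ι → mixedSpace F), ℂ)) (u : ι → mixedSpace F) :
    Continuous fun z => A z Φinf u := by
  let Ψ : FinSB F ι := indicatorSB F ι (piLevelIdeal F ι ⊤) (isOpen_piLevelIdeal F ⊤) (isCompact_piLevelIdeal F ι ⊤)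
  let x : ι → AdeleRing (𝓞 F) F := piAdeleSplit F ι (u, 0)
  let Θ : ↥(piSchwartzBruhat F ι) := piSchwartzBruhatEquiv F ι (Φinf ⊗ₜ Ψ)
  have hΨ0 : (Ψ : (ι → FiniteAdeleRing (𝓞 F) F) → ℂ) 0 = 1 := by
    show ((piLevelIdeal F ι ⊤ : AddSubgroup (ι → FiniteAdeleRing (𝓞 F) F)) :
      Set (ι → FiniteAdeleRing (𝓞 F) F)).indicator (fun _ => (1 : ℂ)) 0 = 1
    exact Set.indicator_of_mem (piLevelIdeal F ι ⊤).zero_mem _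
  have hx1 : piArch F ι x = u := by rw [piArch_piAdeleSplit]
  have hx2 : piFinite F ι x = 0 := by rw [piFinite_piAdeleSplit]
  have hcont : Continuous fun z =>
      ((omegaPsi (adelicSchrodinger F ι T) (p z : adelicMp F ι T) Θ : ↥(piSchwartzBruhat F ι)) :
        (ι → AdeleRing (𝓞 F) F) → ℂ) x :=
    (continuous_omegaPsi_apply Θ x).comp (continuous_subtype_val.comp hp)
  refine hcont.congr fun z => ?_
  have h1 : omegaPsi (adelicSchrodinger F ι T) (p z : adelicMp F ι T) Θ = piSchwartzBruhatEquiv F ι (A z Φinf ⊗ₜ Ψ) := by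
    show adelicMpCont.omega F ι T (p z) Θ = _
    rw [hA z, adelicTensorEnd_apply_tmul, LinearMap.id_apply]
  show ((omegaPsi (adelicSchrodinger F ι T) (p z : adelicMp F ι T) Θ : ↥(piSchwartzBruhat F ι)) :
      (ι → AdeleRing (𝓞 F) F) → ℂ) x = A z Φinf u
  rw [h1, coe_piSchwartzBruhatEquiv_tmul]
  show A z Φinf (piArch F ι x) * (Ψ : (ι → FiniteAdeleRing (𝓞 F) F) → ℂ) (piFinite F ι x) = A z Φinf u
  rw [hx1, hx2, hΨ0, mul_one]

/-- the finite factor read as a coefficient of `q` alone: `(B_z Φ_f)(k) = (ω(q z)(φ₀ ⊗ Φ_f))(0, k)` (`φ₀(0) = 1`), so it is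
continuous in `z`. [cite: Weil1964, Chap. III n° 38 p. 189] -/
private theorem continuous_finCoeff (hq : Continuous q) (B : Z → (FinSB F ι →ₗ[ℂ] FinSB F ι))
    (hB : ∀ z, (adelicMpCont.omega F ι T (q z) : ↥(piSchwartzBruhat F ι) →ₗ[ℂ] ↥(piSchwartzBruhat F ι)) =
      adelicTensorEnd LinearMap.id (B z))
    (Φfin : FinSB F ι) (k : ι → FiniteAdeleRing (𝓞 F) F) :
    Continuous fun z => ((B z Φfin : FinSB F ι) : (ι → FiniteAdeleRing (𝓞 F) F) → ℂ) k := by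
  let x : ι → AdeleRing (𝓞 F) F := piAdeleSplit F ι (0, k)
  let Θ : ↥(piSchwartzBruhat F ι) := piSchwartzBruhatEquiv F ι (unitSchwartz F ι ⊗ₜ Φfin)
  have hx1 : piArch F ι x = 0 := by rw [piArch_piAdeleSplit]
  have hx2 : piFinite F ι x = k := by rw [piFinite_piAdeleSplit]
  have hcont : Continuous fun z =>
      ((omegaPsi (adelicSchrodinger F ι T) (q z : adelicMp F ι T) Θ : ↥(piSchwartzBruhat F ι)) :
        (ι → AdeleRing (𝓞 F) F) → ℂ) x :=
    (continuous_omegaPsi_apply Θ x).comp (continuous_subtype_val.comp hq)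
  refine hcont.congr fun z => ?_
  have h1 : omegaPsi (adelicSchrodinger F ι T) (q z : adelicMp F ι T) Θ =
      piSchwartzBruhatEquiv F ι (unitSchwartz F ι ⊗ₜ B z Φfin) := by
    show adelicMpCont.omega F ι T (q z) Θ = _
    rw [hB z, adelicTensorEnd_apply_tmul, LinearMap.id_apply]
  show ((omegaPsi (adelicSchrodinger F ι T) (q z : adelicMp F ι T) Θ : ↥(piSchwartzBruhat F ι)) :
      (ι → AdeleRing (𝓞 F) F) → ℂ) x = ((B z Φfin : FinSB F ι) : (ι → FiniteAdeleRing (𝓞 F) F) → ℂ) k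
  rw [h1, coe_piSchwartzBruhatEquiv_tmul]
  show unitSchwartz F ι (piArch F ι x) * ((B z Φfin : FinSB F ι) : (ι → FiniteAdeleRing (𝓞 F) F) → ℂ) (piFinite F ι x) = _
  rw [hx1, hx2, unitSchwartz_apply_zero, one_mul]

/-- **matrix coefficients of an (archimedean) · (finite) product are continuous.**  For continuous
`p, q : Z → Mp_ψ(W_𝔸)ᶜᵒⁿᵗ` with `ω(p z) = A_z ⊗ 1` and `ω(q z) = 1 ⊗ B_z`, every `z ↦ (ω(p z)(ω(q z)Φ))(x)` is continuous.
[cite: Weil1964, Chap. III n° 38–39 pp. 189–190] -/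
theorem continuous_omega_omega_apply_of_arch_fin (hp : Continuous p) (hq : Continuous q)
    (hA : ∀ z, ∃ A : 𝓢((ι → mixedSpace F), ℂ) →L[ℂ] 𝓢((ι → mixedSpace F), ℂ),
      (adelicMpCont.omega F ι T (p z) : ↥(piSchwartzBruhat F ι) →ₗ[ℂ] ↥(piSchwartzBruhat F ι)) =
        adelicTensorEnd (A : 𝓢((ι → mixedSpace F), ℂ) →ₗ[ℂ] 𝓢((ι → mixedSpace F), ℂ)) LinearMap.id)
    (hB : ∀ z, ∃ B : FinSB F ι →ₗ[ℂ] FinSB F ι,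
      (adelicMpCont.omega F ι T (q z) : ↥(piSchwartzBruhat F ι) →ₗ[ℂ] ↥(piSchwartzBruhat F ι)) =
        adelicTensorEnd LinearMap.id B)
    (Φ : ↥(piSchwartzBruhat F ι)) (x : ι → AdeleRing (𝓞 F) F) :
    Continuous fun z =>
      ((adelicMpCont.omega F ι T (p z) (adelicMpCont.omega F ι T (q z) Φ) : ↥(piSchwartzBruhat F ι)) :
        (ι → AdeleRing (𝓞 F) F) → ℂ) x := by
  -- choose the operator families
  choose A hA' using hA
  choose B hB' using hB
  -- write `Φ` as the image of a tensor and induct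
  suffices h : ∀ t, Continuous fun z =>
      ((adelicMpCont.omega F ι T (p z) (adelicMpCont.omega F ι T (q z) (piSchwartzBruhatEquiv F ι t)) :
        ↥(piSchwartzBruhat F ι)) : (ι → AdeleRing (𝓞 F) F) → ℂ) x by
    refine (h ((piSchwartzBruhatEquiv F ι).symm Φ)).congr fun z => ?_
    exact congrArg (fun Ψ : ↥(piSchwartzBruhat F ι) =>
      ((adelicMpCont.omega F ι T (p z) (adelicMpCont.omega F ι T (q z) Ψ) : ↥(piSchwartzBruhat F ι)) :
        (ι → AdeleRing (𝓞 F) F) → ℂ) x) ((piSchwartzBruhatEquiv F ι).apply_symm_apply Φ)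
  intro t
  induction t using TensorProduct.induction_on with
  | zero =>
    refine (continuous_const (y := (0 : ℂ))).congr fun z => ?_
    simp only [map_zero, ZeroMemClass.coe_zero, Pi.zero_apply]
  | tmul Φinf Φfin =>
    have hcont := (continuous_archCoeff hp (fun z => (A z : 𝓢((ι → mixedSpace F), ℂ) →ₗ[ℂ] 𝓢((ι → mixedSpace F), ℂ)))
      hA' Φinf (piArch F ι x)).mul (continuous_finCoeff hq B hB' Φfin (piFinite F ι x))
    refine hcont.congr fun z => ?_
    have h1 : adelicMpCont.omega F ι T (q z) (piSchwartzBruhatEquiv F ι (Φinf ⊗ₜ Φfin)) =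
        piSchwartzBruhatEquiv F ι (Φinf ⊗ₜ B z Φfin) := by
      rw [hB' z, adelicTensorEnd_apply_tmul, LinearMap.id_apply]
    have h2 : adelicMpCont.omega F ι T (p z) (piSchwartzBruhatEquiv F ι (Φinf ⊗ₜ B z Φfin)) =
        piSchwartzBruhatEquiv F ι ((A z : 𝓢((ι → mixedSpace F), ℂ) →ₗ[ℂ] 𝓢((ι → mixedSpace F), ℂ)) Φinf ⊗ₜ B z Φfin) := by
      rw [hA' z, adelicTensorEnd_apply_tmul, LinearMap.id_apply]
    have h3 := coe_piSchwartzBruhatEquiv_tmul F ι ((A z : 𝓢((ι → mixedSpace F), ℂ) →ₗ[ℂ] 𝓢((ι → mixedSpace F), ℂ)) Φinf)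
      (B z Φfin)
    show _ = ((adelicMpCont.omega F ι T (p z) (adelicMpCont.omega F ι T (q z)
        (piSchwartzBruhatEquiv F ι (Φinf ⊗ₜ Φfin))) : ↥(piSchwartzBruhat F ι)) : (ι → AdeleRing (𝓞 F) F) → ℂ) x
    rw [h1, h2, h3]
    rfl
  | add t₁ t₂ h₁ h₂ =>
    refine (h₁.add h₂).congr fun z => ?_
    simp only [map_add, Submodule.coe_add, Pi.add_apply]

/-- the same, written for `ω_ψ` of the product `p(z) q(z)` in `Mp_ψ(W_𝔸)`. [cite: Weil1964, Chap. III n° 38–39 pp. 189–190] -/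
theorem continuous_omegaPsi_mul_apply_of_arch_fin (hp : Continuous p) (hq : Continuous q)
    (hA : ∀ z, ∃ A : 𝓢((ι → mixedSpace F), ℂ) →L[ℂ] 𝓢((ι → mixedSpace F), ℂ),
      (adelicMpCont.omega F ι T (p z) : ↥(piSchwartzBruhat F ι) →ₗ[ℂ] ↥(piSchwartzBruhat F ι)) =
        adelicTensorEnd (A : 𝓢((ι → mixedSpace F), ℂ) →ₗ[ℂ] 𝓢((ι → mixedSpace F), ℂ)) LinearMap.id)
    (hB : ∀ z, ∃ B : FinSB F ι →ₗ[ℂ] FinSB F ι,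
      (adelicMpCont.omega F ι T (q z) : ↥(piSchwartzBruhat F ι) →ₗ[ℂ] ↥(piSchwartzBruhat F ι)) =
        adelicTensorEnd LinearMap.id B)
    (Φ : ↥(piSchwartzBruhat F ι)) (x : ι → AdeleRing (𝓞 F) F) :
    Continuous fun z =>
      ((omegaPsi (adelicSchrodinger F ι T) ((p z : adelicMp F ι T) * (q z : adelicMp F ι T)) Φ :
        ↥(piSchwartzBruhat F ι)) : (ι → AdeleRing (𝓞 F) F) → ℂ) x := by
  -- `ω_ψ(p q) Φ = ω(p) (ω(q) Φ)` definitionally (`omegaPsi = toLinearMapMonoidHom ∘ toOp`)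
  exact continuous_omega_omega_apply_of_arch_fin hp hq hA hB Φ x

end Coefficients

/-! ## §3 The product map -/

/-- **Continuity of `z ↦ s_∞(z) · s_f(z)`.**  For continuous `p, q : Z → Mp_ψ(W_𝔸)ᶜᵒⁿᵗ` such that every `ω(p z)` is an
archimedean operator `A ⊗ 1` (`A` continuous on `𝓢(X_∞)`) and every `ω(q z)` a finite operator `1 ⊗ B`, the pointwise product
`z ↦ p(z) q(z)` is continuous — e.g. `Z = H(𝔸)`, `p = s_∞ ∘ archPart`, `q = s_f ∘ finPart` for the two halves of a global
splitting. [cite: Weil1964, Chap. III n° 38–39 pp. 189–190] -/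
theorem continuous_mul_of_arch_fin {p q : Z → adelicMpCont F ι T} (hp : Continuous p) (hq : Continuous q)
    (hA : ∀ z, ∃ A : 𝓢((ι → mixedSpace F), ℂ) →L[ℂ] 𝓢((ι → mixedSpace F), ℂ),
      (adelicMpCont.omega F ι T (p z) : ↥(piSchwartzBruhat F ι) →ₗ[ℂ] ↥(piSchwartzBruhat F ι)) =
        adelicTensorEnd (A : 𝓢((ι → mixedSpace F), ℂ) →ₗ[ℂ] 𝓢((ι → mixedSpace F), ℂ)) LinearMap.id)
    (hB : ∀ z, ∃ B : FinSB F ι →ₗ[ℂ] FinSB F ι,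
      (adelicMpCont.omega F ι T (q z) : ↥(piSchwartzBruhat F ι) →ₗ[ℂ] ↥(piSchwartzBruhat F ι)) =
        adelicTensorEnd LinearMap.id B) :
    Continuous fun z => p z * q z := by
  rw [continuous_into_adelicMpCont_iff, continuous_into_adelicMp_iff]
  exact ⟨fun w => continuous_proj_mul_apply (p := fun z => (p z : adelicMp F ι T)) (q := fun z => (q z : adelicMp F ι T))
      (continuous_subtype_val.comp hp) (continuous_subtype_val.comp hq) w,
    fun Φ x => continuous_omegaPsi_mul_apply_of_arch_fin hp hq hA hB Φ x⟩

/-- **Hom form**: for continuous homomorphisms `sa : G₁ →* Mp_ψ(W_𝔸)ᶜᵒⁿᵗ` (archimedean operators) and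
`sf : G₂ →* Mp_ψ(W_𝔸)ᶜᵒⁿᵗ` (finite operators) and continuous `a : Z → G₁`, `b : Z → G₂`, the map `z ↦ sa (a z) · sf (b z)` is
continuous (the shape of `assemble = noncommCoprod sa sf ∘ (archPart, finPart)`). [cite: Weil1964, Chap. III n° 38–39 pp. 189–190] -/
theorem continuous_mul_hom_of_arch_fin {G₁ G₂ : Type*} [Group G₁] [Group G₂] [TopologicalSpace G₁] [TopologicalSpace G₂]
    {sa : G₁ →* adelicMpCont F ι T} {sf : G₂ →* adelicMpCont F ι T} (hsa : Continuous sa) (hsf : Continuous sf)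
    (hA : ∀ g, ∃ A : 𝓢((ι → mixedSpace F), ℂ) →L[ℂ] 𝓢((ι → mixedSpace F), ℂ),
      (adelicMpCont.omega F ι T (sa g) : ↥(piSchwartzBruhat F ι) →ₗ[ℂ] ↥(piSchwartzBruhat F ι)) =
        adelicTensorEnd (A : 𝓢((ι → mixedSpace F), ℂ) →ₗ[ℂ] 𝓢((ι → mixedSpace F), ℂ)) LinearMap.id)
    (hB : ∀ g, ∃ B : FinSB F ι →ₗ[ℂ] FinSB F ι,
      (adelicMpCont.omega F ι T (sf g) : ↥(piSchwartzBruhat F ι) →ₗ[ℂ] ↥(piSchwartzBruhat F ι)) =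
        adelicTensorEnd LinearMap.id B)
    {a : Z → G₁} {b : Z → G₂} (ha : Continuous a) (hb : Continuous b) :
    Continuous fun z => sa (a z) * sf (b z) :=
  continuous_mul_of_arch_fin (hsa.comp ha) (hsf.comp hb) (fun z => hA (a z)) (fun z => hB (b z))

end Literature.NumberTheory.Weil1964
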